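import Literature.NumberTheory.Automorphic.MeyerRatLogPrimitive
import Literature.NumberTheory.Automorphic.MeyerDefectFunctions
import Literature.NumberTheory.Automorphic.MeyerRatThetaHminus
import Literature.NumberTheory.Automorphic.MeyerUnramifiedRepresentatives
import HarnessLib

/-!
# Meyer's global difference representation — proofs, `K = ℚ`: the Jordan chains `R_s^j h₀` and
# their translation defects

Topic `NumberTheory/Automorphic`; namespace `Literature.NumberTheory.Automorphic.Meyer`. Sibling
PROOF file for Step D (lower bound) of the plan for `Meyer.spectralRealisation_rat`
[Meyer2005, Thm. 5.11]:

* theta vectors of compact test functions: `h_G = Σ(G ⊗ 1_Ẑ) ∈ H₋`, unramified, `i₋ h_G ∈ H₊`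
  (when `∫ G = 0`), with Mellin transform `ζ(z) MG(z)` on `Re z > 1` (`mellin_meyerSum_ratTensor`);
* **the chain** `chain s h₀ j = R_s^j h₀` (`classLogPrimitive`) of an unramified `h₀ ∈ H₋` whose
  Mellin transform `Z` has a zero of order `J` at `s`: for `j ≤ J`, `chain j ∈ H₋` is unramified,
  `(z - s)^j 𝓜(chain j) = Z` and `ord_s 𝓜(chain j) = J - j` (`chain_package`);
* **the defect identity** (`classTranslate_chain_sub_eq`): for `h₀ = h_{G₀}` and every idele class
  `g`, `a = log |g|`,
  `λ_g (chain (k+1)) - e^{as} chain (k+1) = ∑_{i<k} E_i(s) · chain (k-i) + h_{G_k}`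
  with the divided differences `E_i = expSlope a s i` and the defect test functions
  `G_k = defectTest G₀ s a k` of `MeyerDefectFunctions` — proved by comparing Mellin transforms on
  `Re z > 1` (`eq_of_mellin_eqOn`). These are the relations making `span{[i₋ chain j]}` a
  `π₋`-invariant subspace of the generalised `|x|^s`-eigenspace [Meyer2005, Thm. 5.11].

Everything is proved; the only definition is `chain`.

## References

* R. Meyer, *On a representation of the idele class group related to primes and zeros of
  L-functions*, Duke Math. J. 127 (2005) = arXiv:math/0311468, Thm. 5.11 [Meyer2005].
-/

noncomputable section

open MeasureTheory Set Filter Complex NumberField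
open scoped Topology

namespace Literature.NumberTheory.Automorphic.Meyer

/-! ### Orders of vanishing: bookkeeping lemmas -/

section Orders

/-- `ord_s (z - s)^j = j`. [folklore] -/
theorem analyticOrderAt_pow_sub (s : ℂ) (j : ℕ) : analyticOrderAt (fun z : ℂ => (z - s) ^ j) s = j := by
  rw [AnalyticAt.analyticOrderAt_eq_natCast (by fun_prop)]
  exact ⟨fun _ => 1, analyticAt_const, one_ne_zero, Eventually.of_forall fun z => by simp⟩

/-- If `(z - s)^j F = N` with `F, N` entire then `ord_s N = j + ord_s F`. [folklore] -/
theorem analyticOrderAt_eq_add_of_pow_mul_eq {F N : ℂ → ℂ} (hF : Differentiable ℂ F) (s : ℂ) (j : ℕ)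
    (h : ∀ z : ℂ, (z - s) ^ j * F z = N z) : analyticOrderAt N s = j + analyticOrderAt F s := by
  have hN : N = (fun z : ℂ => (z - s) ^ j) * F := by funext z; exact (h z).symm
  rw [hN, analyticOrderAt_mul (by fun_prop) (hF.analyticAt s), analyticOrderAt_pow_sub]

/-- From `(z - s)^j F = N` and `ord_s N = J ≥ j`: `ord_s F = J - j`. [folklore] -/
theorem analyticOrderAt_eq_sub_of_pow_mul_eq {F N : ℂ → ℂ} (hF : Differentiable ℂ F) (s : ℂ) {j J : ℕ}
    (h : ∀ z : ℂ, (z - s) ^ j * F z = N z) (hN : analyticOrderAt N s = J) (hj : j ≤ J) :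
    analyticOrderAt F s = ((J - j : ℕ) : ℕ∞) := by
  have h1 := analyticOrderAt_eq_add_of_pow_mul_eq hF s j h
  rw [hN] at h1
  induction hx : analyticOrderAt F s using ENat.recTopCoe with
  | top => rw [hx] at h1; simp at h1
  | coe n =>
    rw [hx] at h1
    norm_cast at h1
    norm_cast
    omega

/-- An analytic function with positive order vanishes. [folklore] -/
theorem apply_eq_zero_of_analyticOrderAt_ne_zero {F : ℂ → ℂ} {s : ℂ} (hF : AnalyticAt ℂ F s)
    (h : analyticOrderAt F s ≠ 0) : F s = 0 := by
  by_contra hne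
  exact h (hF.analyticOrderAt_eq_zero.mpr hne)

end Orders

/-! ### Theta vectors of compact test functions -/

section Theta

variable [MeasurableSpace (AdeleRing (𝓞 ℚ) ℚ)] [BorelSpace (AdeleRing (𝓞 ℚ) ℚ)]
  (μ : Measure (AdeleRing (𝓞 ℚ) ℚ)) [μ.IsAddHaarMeasure]

omit [MeasurableSpace (AdeleRing (𝓞 ℚ) ℚ)] [BorelSpace (AdeleRing (𝓞 ℚ) ℚ)] in
/-- `ratTensor` only depends on the function. [folklore] -/
theorem ratTensor_toSchwartz {G : ℝ → ℂ} (hG : IsCompactTest G) : ratTensor (⇑hG.toSchwartz) = ratTensor G := rfl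

/-- **`h_G = Σ(G ⊗ 1_Ẑ) ∈ H₋`** for a compact test function with `∫ G = 0` (and the self-dual Haar
measure). [cite: Meyer2005, §5.4] -/
theorem meyerSum_ratTensor_mem_Hminus_of_isCompactTest (hμ : μ (adeleFundamentalDomain ℚ) = 1) {G : ℝ → ℂ}
    (hG : IsCompactTest G) (h0 : ∫ t : ℝ, G t = 0) : meyerSum ℚ (ratTensor G) ∈ Hminus ℚ := by
  have h := meyerSum_ratTensor_mem_Hminus (μ := μ) hμ hG.toSchwartz (hG.eq_zero_of_nonpos le_rfl) h0
  rwa [ratTensor_toSchwartz] at h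

/-- **`i₋ h_G ∈ H₊`** for a compact test function with `∫ G = 0`. [cite: Meyer2005, §5.4] -/
theorem iMinus_meyerSum_ratTensor_mem_Hplus_of_isCompactTest (hμ : μ (adeleFundamentalDomain ℚ) = 1) {G : ℝ → ℂ}
    (hG : IsCompactTest G) (h0 : ∫ t : ℝ, G t = 0) : iMinus ℚ (meyerSum ℚ (ratTensor G)) ∈ Hplus ℚ μ := by
  have h := iMinus_meyerSum_ratTensor_mem_Hplus μ hμ hG.toSchwartz (hG.eq_zero_of_nonpos le_rfl) h0
  rwa [ratTensor_toSchwartz] at h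

omit [MeasurableSpace (AdeleRing (𝓞 ℚ) ℚ)] [BorelSpace (AdeleRing (𝓞 ℚ) ℚ)] in
/-- `h_G` is unramified. [cite: Meyer2005, §5.2] -/
theorem meyerSum_ratTensor_unramified (G : ℝ → ℂ) :
    ∀ u ∈ integralFiniteUnits ℚ, ∀ x, meyerSum ℚ (ratTensor G) (x * finiteUnitClass ℚ u) = meyerSum ℚ (ratTensor G) x :=
  fun _ hu x => meyerSum_ratTensor_mul_finiteUnitClass G hu x

omit [MeasurableSpace (AdeleRing (𝓞 ℚ) ℚ)] [BorelSpace (AdeleRing (𝓞 ℚ) ℚ)] in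
/-- **`𝓜(h_G)(z) = ζ(z) MG(z)` for `Re z > 1`.** [cite: Meyer2005, §5.7] -/
theorem mellin_meyerSum_ratTensor {G : ℝ → ℂ} (hG : IsCompactTest G) {z : ℂ} (hz : 1 < z.re) :
    mellin (fun t : ℝ => meyerSum ℚ (ratTensor G) (posClass (Real.log t))) z = riemannZeta z * mellin G z := by
  rw [← hG.mellin_theta hz, mellin, mellin]
  refine setIntegral_congr_fun measurableSet_Ioi fun t ht => ?_
  rw [meyerSum_ratTensor_eq, classNorm_posClass, Real.exp_log ht]

end Theta

/-! ### The chain `R_s^j h₀` -/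

section Chain

variable (s : ℂ) (h₀ : IdeleClassGroup ℚ → ℂ)

/-- **The chain `R_s^j h₀`.** [cite: Meyer2005, Thm. 5.11] -/
def chain : ℕ → IdeleClassGroup ℚ → ℂ
  | 0 => h₀
  | j + 1 => classLogPrimitive s (chain j)

/-- `chain 0 = h₀`. [folklore] -/
@[simp]
theorem chain_zero : chain s h₀ 0 = h₀ := rfl

/-- `chain (j+1) = R_s (chain j)`. [folklore] -/
theorem chain_succ (j : ℕ) : chain s h₀ (j + 1) = classLogPrimitive s (chain s h₀ j) := rfl

/-- Every member of the chain is unramified. [folklore] -/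
theorem chain_unramified (hunr : ∀ u ∈ integralFiniteUnits ℚ, ∀ x, h₀ (x * finiteUnitClass ℚ u) = h₀ x) :
    ∀ j : ℕ, ∀ u ∈ integralFiniteUnits ℚ, ∀ x, chain s h₀ j (x * finiteUnitClass ℚ u) = chain s h₀ j x
  | 0 => hunr
  | _ + 1 => classLogPrimitive_unramified s _

variable {s h₀}

/-- **The chain package**: for `j ≤ J = ord_s 𝓜h₀`, `chain j ∈ H₋`, `(z - s)^j 𝓜(chain j) = 𝓜h₀`
and `ord_s 𝓜(chain j) = J - j`. [cite: Meyer2005, Thm. 5.11] -/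
theorem chain_package (hunr : ∀ u ∈ integralFiniteUnits ℚ, ∀ x, h₀ (x * finiteUnitClass ℚ u) = h₀ x)
    (hh₀ : h₀ ∈ Hminus ℚ) {J : ℕ}
    (hJ : analyticOrderAt (mellin (fun t : ℝ => h₀ (posClass (Real.log t)))) s = J) :
    ∀ j : ℕ, j ≤ J →
      chain s h₀ j ∈ Hminus ℚ ∧
        (∀ z : ℂ, (z - s) ^ j * mellin (fun t : ℝ => chain s h₀ j (posClass (Real.log t))) z =
          mellin (fun t : ℝ => h₀ (posClass (Real.log t))) z) ∧
        analyticOrderAt (mellin (fun t : ℝ => chain s h₀ j (posClass (Real.log t)))) s = ((J - j : ℕ) : ℕ∞)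
  | 0 => fun _ => ⟨hh₀, fun z => by simp, by simpa using hJ⟩
  | j + 1 => fun hj => by
      obtain ⟨hmem, hmel, hord⟩ := chain_package hunr hh₀ hJ j (Nat.le_of_succ_le hj)
      have hunrj := chain_unramified s h₀ hunr j
      -- the Mellin transform of `chain j` vanishes at `s`
      have hvan : mellin (fun t : ℝ => chain s h₀ j (posClass (Real.log t))) s = 0 := by
        refine apply_eq_zero_of_analyticOrderAt_ne_zero
          ((differentiable_mellin_of_mem_Hminus hunrj hmem).analyticAt s) ?_
        rw [hord]
        have : 0 < J - j := by omega
        exact_mod_cast this.ne'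
      refine ⟨?_, fun z => ?_, ?_⟩
      · rw [chain_succ]
        exact classLogPrimitive_mem_Hminus s hunrj hmem hvan
      · rw [chain_succ, pow_succ, mul_assoc, mellin_classLogPrimitive s hunrj hmem hvan z]
        exact hmel z
      · have hmel' : ∀ z : ℂ, (z - s) ^ (j + 1) * mellin (fun t : ℝ => chain s h₀ (j + 1) (posClass (Real.log t))) z =
            mellin (fun t : ℝ => h₀ (posClass (Real.log t))) z := by
          intro z
          rw [chain_succ, pow_succ, mul_assoc, mellin_classLogPrimitive s hunrj hmem hvan z]
          exact hmel z
        have hmem' : chain s h₀ (j + 1) ∈ Hminus ℚ := by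
          rw [chain_succ]; exact classLogPrimitive_mem_Hminus s hunrj hmem hvan
        exact analyticOrderAt_eq_sub_of_pow_mul_eq
          (differentiable_mellin_of_mem_Hminus (chain_unramified s h₀ hunr (j + 1)) hmem') s hmel' hJ hj

end Chain

/-! ### The translation defects -/

section Defect

/-- Translates of unramified functions are unramified. [folklore] -/
theorem classTranslate_unramified {f : IdeleClassGroup ℚ → ℂ}
    (hunr : ∀ u ∈ integralFiniteUnits ℚ, ∀ x, f (x * finiteUnitClass ℚ u) = f x) (g : IdeleClassGroup ℚ) :
    ∀ u ∈ integralFiniteUnits ℚ, ∀ x, classTranslate ℚ g f (x * finiteUnitClass ℚ u) = classTranslate ℚ g f x := by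
  intro u hu x
  rw [classTranslate_apply, classTranslate_apply, ← mul_assoc, hunr u hu]

/-- The unramified quasi-character in the logarithmic coordinate: `|g|^s = e^{a s}`, `a = log |g|`.
[cite: Meyer2005, §1 p. 3] -/
theorem normChar_eq_exp (s : ℂ) (g : IdeleClassGroup ℚ) :
    normChar ℚ s g = cexp ((Real.log (classNorm ℚ g) : ℂ) * s) := by
  rw [normChar, Complex.cpow_def_of_ne_zero (Complex.ofReal_ne_zero.mpr (classNorm_ne_zero g)),
    Complex.ofReal_log (classNorm_pos g).le]

/-- `|g|^z = e^{a z}` with `a = log |g|`. [folklore] -/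
theorem ofReal_classNorm_cpow (g : IdeleClassGroup ℚ) (z : ℂ) :
    ((classNorm ℚ g : ℝ) : ℂ) ^ z = cexp ((Real.log (classNorm ℚ g) : ℂ) * z) := by
  rw [Complex.cpow_def_of_ne_zero (Complex.ofReal_ne_zero.mpr (classNorm_ne_zero g)),
    Complex.ofReal_log (classNorm_pos g).le]

/-- Mellin transform of an unramified member of `H₋` minus a scalar multiple of another: linearity
helper. [folklore] -/
theorem mellin_lincomb_of_mem_Hminus {ι : Type} (T : Finset ι) (c : ι → ℂ) {f : ι → IdeleClassGroup ℚ → ℂ}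
    (hunr : ∀ i ∈ T, ∀ u ∈ integralFiniteUnits ℚ, ∀ x, f i (x * finiteUnitClass ℚ u) = f i x)
    (hf : ∀ i ∈ T, f i ∈ Hminus ℚ) (z : ℂ) :
    mellin (fun t : ℝ => ∑ i ∈ T, c i * f i (posClass (Real.log t))) z =
      ∑ i ∈ T, c i * mellin (fun t : ℝ => f i (posClass (Real.log t))) z := by
  rw [mellin]
  have hint : ∀ i ∈ T, Integrable (fun t : ℝ => (t : ℂ) ^ (z - 1) • (c i * f i (posClass (Real.log t))))
      (volume.restrict (Ioi 0)) := by
    intro i hi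
    have := (mellinConvergent_of_mem_Hminus (hunr i hi) (hf i hi) z).const_mul (c i)
    refine this.congr (Eventually.of_forall fun t => ?_)
    simp only [smul_eq_mul]; ring
  have h1 : (∫ t in Ioi (0 : ℝ), (t : ℂ) ^ (z - 1) • ∑ i ∈ T, c i * f i (posClass (Real.log t))) =
      ∫ t in Ioi (0 : ℝ), ∑ i ∈ T, (t : ℂ) ^ (z - 1) • (c i * f i (posClass (Real.log t))) := by
    refine setIntegral_congr_fun measurableSet_Ioi fun t _ => ?_
    rw [Finset.smul_sum]
  rw [h1, integral_finsetSum _ hint]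
  refine Finset.sum_congr rfl fun i _ => ?_
  rw [mellin, ← integral_const_mul]
  refine setIntegral_congr_fun measurableSet_Ioi fun t _ => ?_
  simp only [smul_eq_mul]; ring

variable [MeasurableSpace (AdeleRing (𝓞 ℚ) ℚ)] [BorelSpace (AdeleRing (𝓞 ℚ) ℚ)]
  (μ : Measure (AdeleRing (𝓞 ℚ) ℚ)) [μ.IsAddHaarMeasure]

variable {G₀ : ℝ → ℂ} {s : ℂ}

/-- **The defect identity.** For `h₀ = h_{G₀}` (`G₀` a compact test function with `∫ G₀ = 0`), an
idele class `g` with `a = log |g|`, and `k + 1 ≤ J = ord_s 𝓜h₀` (`Re s < 1`):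
`λ_g (chain (k+1)) - e^{as} chain (k+1) = ∑_{i<k} E_i(s) chain (k-i) + h_{G_k}` where
`G_k = defectTest G₀ s a k`. [cite: Meyer2005, Thm. 5.11] -/
theorem classTranslate_chain_sub_eq (hμ : μ (adeleFundamentalDomain ℚ) = 1) (hG₀ : IsCompactTest G₀)
    (h0 : ∫ t : ℝ, G₀ t = 0) (hs : s.re < 1) {J : ℕ}
    (hJ : analyticOrderAt (mellin (fun t : ℝ => meyerSum ℚ (ratTensor G₀) (posClass (Real.log t)))) s = J)
    (g : IdeleClassGroup ℚ) {k : ℕ} (hk : k + 1 ≤ J) :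
    classTranslate ℚ g (chain s (meyerSum ℚ (ratTensor G₀)) (k + 1)) -
        cexp ((Real.log (classNorm ℚ g) : ℂ) * s) • chain s (meyerSum ℚ (ratTensor G₀)) (k + 1) =
      (fun x => ∑ i ∈ Finset.range k,
          expSlope (Real.log (classNorm ℚ g)) s i s * chain s (meyerSum ℚ (ratTensor G₀)) (k - i) x) +
        meyerSum ℚ (ratTensor (defectTest G₀ s (Real.log (classNorm ℚ g)) k)) := by
  set h₀ := meyerSum ℚ (ratTensor G₀) with hh₀def
  set a : ℝ := Real.log (classNorm ℚ g) with ha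
  have hunr₀ : ∀ u ∈ integralFiniteUnits ℚ, ∀ x, h₀ (x * finiteUnitClass ℚ u) = h₀ x := meyerSum_ratTensor_unramified G₀
  have hh₀ : h₀ ∈ Hminus ℚ := meyerSum_ratTensor_mem_Hminus_of_isCompactTest μ hμ hG₀ h0
  have hpack := chain_package hunr₀ hh₀ hJ
  have hunrj := chain_unramified s h₀ hunr₀
  -- the defect test function and its theta vector
  have hGk : IsCompactTest (defectTest G₀ s a k) := isCompactTest_defectTest s a hG₀ k
  have hGk0 : ∫ t : ℝ, defectTest G₀ s a k t = 0 := integral_defectTest_eq_zero s a hG₀ h0 k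
  have hnk : meyerSum ℚ (ratTensor (defectTest G₀ s a k)) ∈ Hminus ℚ :=
    meyerSum_ratTensor_mem_Hminus_of_isCompactTest μ hμ hGk hGk0
  have hnku := meyerSum_ratTensor_unramified (defectTest G₀ s a k)
  -- both sides are unramified members of `H₋`
  set c : ℂ := cexp ((a : ℂ) * s) with hc
  set L : IdeleClassGroup ℚ → ℂ := classTranslate ℚ g (chain s h₀ (k + 1)) - c • chain s h₀ (k + 1) with hL
  set R : IdeleClassGroup ℚ → ℂ := (fun x => ∑ i ∈ Finset.range k, expSlope a s i s * chain s h₀ (k - i) x) +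
    meyerSum ℚ (ratTensor (defectTest G₀ s a k)) with hR
  have hmemk1 : chain s h₀ (k + 1) ∈ Hminus ℚ := (hpack (k + 1) hk).1
  have hLmem : L ∈ Hminus ℚ :=
    Submodule.sub_mem _ (classTranslate_mem_ideleClassSchwartzWeighted hmemk1 g) (Submodule.smul_mem _ _ hmemk1)
  have hLunr : ∀ u ∈ integralFiniteUnits ℚ, ∀ x, L (x * finiteUnitClass ℚ u) = L x := by
    intro u hu x
    simp only [hL, Pi.sub_apply, Pi.smul_apply, classTranslate_unramified (hunrj (k + 1)) g u hu x, hunrj (k + 1) u hu x]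
  have hsum_mem : (fun x => ∑ i ∈ Finset.range k, expSlope a s i s * chain s h₀ (k - i) x) ∈ Hminus ℚ := by
    have : (fun x => ∑ i ∈ Finset.range k, expSlope a s i s * chain s h₀ (k - i) x) =
        ∑ i ∈ Finset.range k, expSlope a s i s • chain s h₀ (k - i) := by
      funext x; simp [Finset.sum_apply]
    rw [this]
    refine Submodule.sum_mem _ fun i hi => Submodule.smul_mem _ _ (hpack (k - i) ?_).1
    have := Finset.mem_range.mp hi
    omega
  have hRmem : R ∈ Hminus ℚ := Submodule.add_mem _ hsum_mem hnk
  have hRunr : ∀ u ∈ integralFiniteUnits ℚ, ∀ x, R (x * finiteUnitClass ℚ u) = R x := by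
    intro u hu x
    simp only [hR, Pi.add_apply, hnku u hu x, hunrj _ u hu x]
  -- compare Mellin transforms on `Re z > 1`
  refine eq_of_mellin_eqOn hLunr hLmem hRunr hRmem fun z hz => ?_
  have hzs : z - s ≠ 0 := by
    intro h
    have := congrArg Complex.re (sub_eq_zero.mp h)
    linarith
  have hzs' : (z - s) ^ (k + 1) ≠ 0 := pow_ne_zero _ hzs
  -- Mellin of `L`
  have hML : mellin (fun t : ℝ => L (posClass (Real.log t))) z =
      (cexp ((a : ℂ) * z) - c) * mellin (fun t : ℝ => chain s h₀ (k + 1) (posClass (Real.log t))) z := by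
    have h1 := mellin_sub_of_mem_Hminus (classTranslate_unramified (hunrj (k + 1)) g)
      (classTranslate_mem_ideleClassSchwartzWeighted hmemk1 g)
      (fun u hu x => by simp only [Pi.smul_apply, hunrj (k + 1) u hu x]) (Submodule.smul_mem _ c hmemk1) z
    rw [hL, h1, mellin_classTranslate_eq (hunrj (k + 1)) g z, ofReal_classNorm_cpow, ← ha]
    have h2 : mellin (fun t : ℝ => (c • chain s h₀ (k + 1)) (posClass (Real.log t))) z =
        c * mellin (fun t : ℝ => chain s h₀ (k + 1) (posClass (Real.log t))) z := by
      rw [mellin, mellin, ← integral_const_mul]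
      refine setIntegral_congr_fun measurableSet_Ioi fun t _ => ?_
      simp only [Pi.smul_apply, smul_eq_mul]; ring
    rw [h2]
    ring
  -- Mellin of `R`
  have hMR : mellin (fun t : ℝ => R (posClass (Real.log t))) z =
      ∑ i ∈ Finset.range k, expSlope a s i s * mellin (fun t : ℝ => chain s h₀ (k - i) (posClass (Real.log t))) z +
        riemannZeta z * (expSlope a s k z * mellin G₀ z) := by
    have h1 : mellin (fun t : ℝ => R (posClass (Real.log t))) z =
        mellin (fun t : ℝ => ∑ i ∈ Finset.range k, expSlope a s i s * chain s h₀ (k - i) (posClass (Real.log t))) z +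
          mellin (fun t : ℝ => meyerSum ℚ (ratTensor (defectTest G₀ s a k)) (posClass (Real.log t))) z := by
      have hsum_unr : ∀ u ∈ integralFiniteUnits ℚ, ∀ x,
          (fun x => ∑ i ∈ Finset.range k, expSlope a s i s * chain s h₀ (k - i) x) (x * finiteUnitClass ℚ u) =
            (fun x => ∑ i ∈ Finset.range k, expSlope a s i s * chain s h₀ (k - i) x) x := by
        intro u hu x
        simp only [hunrj _ u hu x]
      rw [hR, mellin, mellin, mellin, ← integral_add (mellinConvergent_of_mem_Hminus hsum_unr hsum_mem z)
        (mellinConvergent_of_mem_Hminus hnku hnk z)]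
      refine setIntegral_congr_fun measurableSet_Ioi fun t _ => ?_
      simp only [Pi.add_apply, smul_eq_mul, mul_add]
    rw [h1, mellin_lincomb_of_mem_Hminus (Finset.range k) (fun i => expSlope a s i s)
      (fun i hi => hunrj (k - i)) (fun i hi => (hpack (k - i) (by have := Finset.mem_range.mp hi; omega)).1) z,
      mellin_meyerSum_ratTensor hGk hz, mellin_defectTest s a hG₀ k z]
  -- multiply by `(z - s)^{k+1}` and use the chain relations, `Z = ζ MG₀` and the telescoping identity
  have hZ : mellin (fun t : ℝ => h₀ (posClass (Real.log t))) z = riemannZeta z * mellin G₀ z :=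
    mellin_meyerSum_ratTensor hG₀ hz
  have key : (z - s) ^ (k + 1) * mellin (fun t : ℝ => L (posClass (Real.log t))) z =
      (z - s) ^ (k + 1) * mellin (fun t : ℝ => R (posClass (Real.log t))) z := by
    rw [hML, hMR, mul_add, Finset.mul_sum]
    have hterms : ∀ i ∈ Finset.range k,
        (z - s) ^ (k + 1) * (expSlope a s i s * mellin (fun t : ℝ => chain s h₀ (k - i) (posClass (Real.log t))) z) =
          expSlope a s i s * (z - s) ^ (i + 1) * mellin (fun t : ℝ => h₀ (posClass (Real.log t))) z := by
      intro i hi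
      have hik : i < k := Finset.mem_range.mp hi
      have hrel := (hpack (k - i) (by omega)).2.1 z
      rw [← hrel, show k + 1 = (i + 1) + (k - i) by omega, pow_add]
      ring
    rw [Finset.sum_congr rfl hterms]
    have hrel := (hpack (k + 1) hk).2.1 z
    calc (z - s) ^ (k + 1) * ((cexp ((a : ℂ) * z) - c) * mellin (fun t : ℝ => chain s h₀ (k + 1) (posClass (Real.log t))) z)
        = (cexp ((a : ℂ) * z) - c) * ((z - s) ^ (k + 1) * mellin (fun t : ℝ => chain s h₀ (k + 1) (posClass (Real.log t))) z) := by
          ring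
      _ = (cexp ((a : ℂ) * z) - cexp ((a : ℂ) * s)) * mellin (fun t : ℝ => h₀ (posClass (Real.log t))) z := by
          rw [hrel]
      _ = (∑ i ∈ Finset.range k, expSlope a s i s * (z - s) ^ (i + 1) + (z - s) ^ (k + 1) * expSlope a s k z) *
            mellin (fun t : ℝ => h₀ (posClass (Real.log t))) z := by rw [exp_sub_exp_eq_sum_add]
      _ = ∑ i ∈ Finset.range k, expSlope a s i s * (z - s) ^ (i + 1) * mellin (fun t : ℝ => h₀ (posClass (Real.log t))) z +
            (z - s) ^ (k + 1) * (riemannZeta z * (expSlope a s k z * mellin G₀ z)) := by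
          rw [add_mul, Finset.sum_mul, hZ]
          ring
  exact mul_left_cancel₀ hzs' key

end Defect

end Literature.NumberTheory.Automorphic.Meyer
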